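import Literature.Analysis.FunctionSpaces.PolchinskiSemigroup
import Mathlib.Analysis.SpecialFunctions.ExpDeriv
import HarnessLib

/-!
# Shifted and compressed covariance decompositions (Bauerschmidt–Bodineau–Dagallier §3.1, Remark 2)

Topic `Literature/Analysis/FunctionSpaces`; a DEFINITIONS file for the Polchinski-flow vocabulary of
`MultiscaleBakryEmery.lean` (`Polchinski.CovDecomposition`, `renormPotential`, `semigroup`, `renormExpect`).
[BBD] Remark 2 (p0015 L100 – p0016 L9): «the condition (e:assCt-mon)–(e:LSI-mon) is invariant under
reparametrisation in `t`: if `a : [0,+∞] → [0,+∞]` is a smooth reparametrisation, set `C^a_t = C_{a(t)}`,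
`V^a_t = V_{a(t)}`; then `Ċ^a_t = ȧ(t)Ċ_{a(t)}` … Analogously, one can parametrise by `[0,T]` instead of
`[0,+∞]`, i.e. use a covariance decomposition `C = ∫₀^T Ċ_t dt`.»  Together with the semigroup structure
`P_{C_{s+τ}} = P_{C_s} ∗ P_{C_{s+τ}−C_s}` ((eq: semigroup structure), p0014 L16–22) this gives two new
covariance decompositions built from a given one:

* `CovDecomposition.shift D s` — the decomposition RESTARTED at scale `s ≥ 0`:
  `C'_τ = C_{s+τ} − C_s`, `Ċ'_τ = Ċ_{s+τ}`, `C'_∞ = C_∞ − C_s`.  Its renormalised potential started from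
  `V_s` is `V'_τ = V_{s+τ}`, its Polchinski semigroup is `P'_{0,τ} = P_{s,s+τ}` and its renormalised
  measure is `ν'_τ = ν_{s+τ}` (`renormPotential_shift`, `semigroup_shift_zero`, `renormExpect_shift`) —
  so every statement proved «at `s = 0`» for an arbitrary decomposition transfers to a general initial
  scale `s`.
* `CovDecomposition.compress D T` — the decomposition COMPRESSED onto `[0,T]` by the time change
  `a(r) = T(1 − e^{−r})`: `C''_r = C_{a(r)}`, `Ċ''_r = ȧ(r)Ċ_{a(r)}`, `C''_∞ = C_T`.  Its renormalised
  potential is `V''_r = V_{a(r)}`, its semigroup `P''_{r,r'} = P_{a(r),a(r')}`, and its renormalised measure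
  is built on the fluctuation covariance `C_T − C_{a(r)}` (`renormPotential_compress`, `semigroup_compress`)
  — so statements about `C_∞ − C_t` transfer to `C_T − C_s`, `s < T`.

Definitions with bodies, plus unfolding / transfer lemmas (all proved).  No new named facts.
Nothing here concerns Yang–Mills.

## References

* [BauerschmidtBodineauDagallier2023] R. Bauerschmidt, T. Bodineau, B. Dagallier, Probab. Surveys 21
  (2024) 200–290, arXiv:2307.07619 — §3.1 (eq: semigroup structure) p0014 L16–22, Def 2 p0013,
  Remark 2 p0015 L100 – p0016 L9. READ (held).
-/

noncomputable section

open MeasureTheory ProbabilityTheory Filter Topology Set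
open scoped RealInnerProductSpace Matrix MatrixOrder

namespace Literature.Analysis.FunctionSpaces

namespace Polchinski

variable {N : ℕ}

namespace CovDecomposition

/-- **The covariance decomposition restarted at scale `s`** ([BBD] (eq: semigroup structure): the
Gaussian field beyond scale `s` decomposes with the increments `C_{s+τ} − C_s`): `C'_τ = C_{s+τ} − C_s`,
`Ċ'_τ = Ċ_{s+τ}`, `C̈'_τ = C̈_{s+τ}`, `C'_∞ = C_∞ − C_s`. [cite: BauerschmidtBodineauDagallier2023, §3.1 (eq: semigroup structure)] -/
def shift (D : CovDecomposition N) (s : ℝ) (hs : 0 ≤ s) : CovDecomposition N where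
  C τ := D.C (s + τ) - D.C s
  Cdot τ := D.Cdot (s + τ)
  Cddot τ := D.Cddot (s + τ)
  Cinf := D.Cinf - D.C s
  C_zero := by simp
  hasDerivAt_C τ hτ i j := by
    have h := (D.hasDerivAt_C (s + τ) (by linarith) i j).comp τ ((hasDerivAt_id τ).const_add s)
    simp only [Function.comp_def, mul_one] at h
    simp only [Matrix.sub_apply]
    exact h.sub_const _
  hasDerivAt_Cdot τ hτ i j := by
    have h := (D.hasDerivAt_Cdot (s + τ) (by linarith) i j).comp τ ((hasDerivAt_id τ).const_add s)
    simp only [Function.comp_def, mul_one] at h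
    exact h
  posSemidef_Cdot τ hτ := D.posSemidef_Cdot (s + τ) (by linarith)
  bounded_Cdot := by
    obtain ⟨M, hM⟩ := D.bounded_Cdot
    exact ⟨M, fun τ hτ i j => hM (s + τ) (by linarith) i j⟩
  tendsto_C i j := by
    have h := ((D.tendsto_C i j).comp (tendsto_atTop_add_const_left atTop s tendsto_id)).sub_const
      (D.C s i j)
    simpa [Matrix.sub_apply] using h

/-- `C'_τ = C_{s+τ} − C_s`. [cite: BauerschmidtBodineauDagallier2023, §3.1 (eq: semigroup structure)] -/
@[simp] theorem shift_C (D : CovDecomposition N) {s : ℝ} (hs : 0 ≤ s) (τ : ℝ) :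
    (D.shift s hs).C τ = D.C (s + τ) - D.C s := rfl

/-- `Ċ'_τ = Ċ_{s+τ}`. [cite: BauerschmidtBodineauDagallier2023, §3.1 (eq: semigroup structure)] -/
@[simp] theorem shift_Cdot (D : CovDecomposition N) {s : ℝ} (hs : 0 ≤ s) (τ : ℝ) :
    (D.shift s hs).Cdot τ = D.Cdot (s + τ) := rfl

/-- `C̈'_τ = C̈_{s+τ}`. [cite: BauerschmidtBodineauDagallier2023, §3.1 (eq: semigroup structure)] -/
@[simp] theorem shift_Cddot (D : CovDecomposition N) {s : ℝ} (hs : 0 ≤ s) (τ : ℝ) :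
    (D.shift s hs).Cddot τ = D.Cddot (s + τ) := rfl

/-- `C'_∞ = C_∞ − C_s`. [cite: BauerschmidtBodineauDagallier2023, §3.1 (eq: semigroup structure)] -/
@[simp] theorem shift_Cinf (D : CovDecomposition N) {s : ℝ} (hs : 0 ≤ s) :
    (D.shift s hs).Cinf = D.Cinf - D.C s := rfl

/-- The fluctuation covariance of the shifted decomposition: `C'_∞ − C'_τ = C_∞ − C_{s+τ}`. [cite: BauerschmidtBodineauDagallier2023, §3.1 (eq: semigroup structure)] -/
theorem shift_Cinf_sub_C (D : CovDecomposition N) {s : ℝ} (hs : 0 ≤ s) (τ : ℝ) :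
    (D.shift s hs).Cinf - (D.shift s hs).C τ = D.Cinf - D.C (s + τ) := by
  simp [sub_sub_sub_cancel_right]

/-- Increments of the shifted decomposition: `C'_τ' − C'_τ = C_{s+τ'} − C_{s+τ}`. [cite: BauerschmidtBodineauDagallier2023, §3.1 (eq: semigroup structure)] -/
theorem shift_C_sub_C (D : CovDecomposition N) {s : ℝ} (hs : 0 ≤ s) (τ τ' : ℝ) :
    (D.shift s hs).C τ' - (D.shift s hs).C τ = D.C (s + τ') - D.C (s + τ) := by
  simp [sub_sub_sub_cancel_right]

/-- The time change `a(r) = T(1 − e^{−r})` of the compression onto `[0,T]` (a smooth reparametrisation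
`[0,∞) → [0,T)`, [BBD] Remark 2). [cite: BauerschmidtBodineauDagallier2023, Remark 2] -/
def compressTime (T r : ℝ) : ℝ := T * (1 - Real.exp (-r))

/-- `a(0) = 0`. [cite: BauerschmidtBodineauDagallier2023, Remark 2] -/
theorem compressTime_zero (T : ℝ) : compressTime T 0 = 0 := by simp [compressTime]

/-- `a(r) ≥ 0` for `r ≥ 0`. [cite: BauerschmidtBodineauDagallier2023, Remark 2] -/
theorem compressTime_nonneg {T : ℝ} (hT : 0 ≤ T) {r : ℝ} (hr : 0 ≤ r) : 0 ≤ compressTime T r := by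
  unfold compressTime
  refine mul_nonneg hT ?_
  have : Real.exp (-r) ≤ 1 := Real.exp_le_one_iff.2 (by linarith)
  linarith

/-- `a(r) < T`. [cite: BauerschmidtBodineauDagallier2023, Remark 2] -/
theorem compressTime_lt {T : ℝ} (hT : 0 < T) (r : ℝ) : compressTime T r < T := by
  unfold compressTime
  have : 0 < Real.exp (-r) := Real.exp_pos _
  nlinarith

/-- `ȧ(r) = T e^{−r}`. [cite: BauerschmidtBodineauDagallier2023, Remark 2] -/
theorem hasDerivAt_compressTime (T r : ℝ) :
    HasDerivAt (compressTime T) (T * Real.exp (-r)) r := by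
  unfold compressTime
  have h : HasDerivAt (fun r => 1 - Real.exp (-r)) (Real.exp (-r)) r := by
    have h1 := ((hasDerivAt_id r).neg.exp).const_sub 1
    simpa using h1
  exact h.const_mul T

/-- `ä(r) = −T e^{−r}`. [cite: BauerschmidtBodineauDagallier2023, Remark 2] -/
theorem hasDerivAt_deriv_compressTime (T r : ℝ) :
    HasDerivAt (fun r => T * Real.exp (-r)) (-(T * Real.exp (-r))) r := by
  have h1 := ((hasDerivAt_id r).neg.exp).const_mul T
  simpa using h1

/-- `a(r) → T` as `r → ∞`. [cite: BauerschmidtBodineauDagallier2023, Remark 2] -/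
theorem tendsto_compressTime (T : ℝ) : Tendsto (compressTime T) atTop (𝓝 T) := by
  unfold compressTime
  have h : Tendsto (fun r : ℝ => Real.exp (-r)) atTop (𝓝 0) :=
    Real.tendsto_exp_atBot.comp tendsto_neg_atTop_atBot
  have h2 := (h.const_sub 1).const_mul T
  simpa using h2

/-- **The covariance decomposition compressed onto `[0,T]`** ([BBD] Remark 2: reparametrisation
`C^a_r = C_{a(r)}`, `Ċ^a_r = ȧ(r)Ċ_{a(r)}`, `C̈^a_r = ä(r)Ċ_{a(r)} + ȧ(r)²C̈_{a(r)}`, and «parametrise by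
`[0,T]` instead of `[0,+∞]`»), with the time change `a(r) = T(1 − e^{−r})`, so that `C''_∞ = C_T`.
[cite: BauerschmidtBodineauDagallier2023, Remark 2] -/
def compress (D : CovDecomposition N) (T : ℝ) (hT : 0 < T) : CovDecomposition N where
  C r := D.C (compressTime T r)
  Cdot r := (T * Real.exp (-r)) • D.Cdot (compressTime T r)
  Cddot r := (-(T * Real.exp (-r))) • D.Cdot (compressTime T r) +
    (T * Real.exp (-r)) ^ 2 • D.Cddot (compressTime T r)
  Cinf := D.C T
  C_zero := by rw [compressTime_zero, D.C_zero]
  hasDerivAt_C r hr i j := by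
    have ha := hasDerivAt_compressTime T r
    have h := (D.hasDerivAt_C (compressTime T r) (compressTime_nonneg hT.le hr) i j).comp r ha
    simp only [Function.comp_def] at h
    simp only [Matrix.smul_apply, smul_eq_mul]
    exact h.congr_deriv (by ring)
  hasDerivAt_Cdot r hr i j := by
    have ha := hasDerivAt_compressTime T r
    have h1 := (D.hasDerivAt_Cdot (compressTime T r) (compressTime_nonneg hT.le hr) i j).comp r ha
    simp only [Function.comp_def] at h1
    have h2 := hasDerivAt_deriv_compressTime T r
    have h := h2.mul h1
    simp only [Matrix.add_apply, Matrix.smul_apply, smul_eq_mul]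
    exact h.congr_deriv (by ring)
  posSemidef_Cdot r hr :=
    (D.posSemidef_Cdot (compressTime T r) (compressTime_nonneg hT.le hr)).smul (by positivity)
  bounded_Cdot := by
    obtain ⟨M, hM⟩ := D.bounded_Cdot
    refine ⟨T * M, fun r hr i j => ?_⟩
    have hM0 : 0 ≤ M := le_trans (abs_nonneg _) (hM 0 le_rfl i j)
    rw [Matrix.smul_apply, smul_eq_mul, abs_mul, abs_of_pos (by positivity)]
    have he : Real.exp (-r) ≤ 1 := Real.exp_le_one_iff.2 (by linarith)
    calc T * Real.exp (-r) * |D.Cdot (compressTime T r) i j| ≤ T * 1 * M := by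
          gcongr
          exact hM _ (compressTime_nonneg hT.le hr) i j
      _ = T * M := by ring
  tendsto_C i j :=
    ((D.hasDerivAt_C T hT.le i j).continuousAt.tendsto).comp (tendsto_compressTime T)

/-- `C''_r = C_{a(r)}`. [cite: BauerschmidtBodineauDagallier2023, Remark 2] -/
@[simp] theorem compress_C (D : CovDecomposition N) {T : ℝ} (hT : 0 < T) (r : ℝ) :
    (D.compress T hT).C r = D.C (compressTime T r) := rfl

/-- `Ċ''_r = ȧ(r) Ċ_{a(r)}`. [cite: BauerschmidtBodineauDagallier2023, Remark 2] -/
@[simp] theorem compress_Cdot (D : CovDecomposition N) {T : ℝ} (hT : 0 < T) (r : ℝ) :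
    (D.compress T hT).Cdot r = (T * Real.exp (-r)) • D.Cdot (compressTime T r) := rfl

/-- `C''_∞ = C_T`. [cite: BauerschmidtBodineauDagallier2023, Remark 2] -/
@[simp] theorem compress_Cinf (D : CovDecomposition N) {T : ℝ} (hT : 0 < T) :
    (D.compress T hT).Cinf = D.C T := rfl

end CovDecomposition

/-! ### Transfer of the Polchinski-flow objects -/

section Transfer

variable (D : CovDecomposition N) {V₀ : EuclideanSpace ℝ (Fin N) → ℝ}

/-- **Compressing the flow onto `[0,T]`**: the renormalised potential of the compressed decomposition is
`V''_r = V_{a(r)}` (by definition, `C''_r = C_{a(r)}`; [BBD] Remark 2 «`V^a_t = V_{a(t)}`»).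
[cite: BauerschmidtBodineauDagallier2023, Remark 2] -/
theorem renormPotential_compress {T : ℝ} (hT : 0 < T) (r : ℝ) (φ : EuclideanSpace ℝ (Fin N)) :
    renormPotential (D.compress T hT) V₀ r φ = renormPotential D V₀ (CovDecomposition.compressTime T r) φ :=
  rfl

/-- The Polchinski semigroup of the compressed decomposition: `P''_{r,r'} = P_{a(r),a(r')}`.
[cite: BauerschmidtBodineauDagallier2023, Remark 2] -/
theorem semigroup_compress {T : ℝ} (hT : 0 < T) (r r' : ℝ) (F : EuclideanSpace ℝ (Fin N) → ℝ)
    (φ : EuclideanSpace ℝ (Fin N)) :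
    semigroup (D.compress T hT) V₀ r r' F φ =
      semigroup D V₀ (CovDecomposition.compressTime T r) (CovDecomposition.compressTime T r') F φ :=
  rfl

/-- The renormalised expectation of the compressed decomposition is built on the fluctuation covariance
`C_T − C_{a(r)}` and normalised by `e^{V_T(0)}`:
`E''_r[F] = e^{V_T(0)} E_{C_T−C_{a(r)}}[e^{−V_{a(r)}} F]` (the «`T` instead of `∞`» version of `E_{ν_t}`,
[BBD] Remark 2). [cite: BauerschmidtBodineauDagallier2023, Remark 2] -/
theorem renormExpect_compress {T : ℝ} (hT : 0 < T) (r : ℝ) (F : EuclideanSpace ℝ (Fin N) → ℝ) :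
    renormExpect (D.compress T hT) V₀ r F =
      Real.exp (renormPotential D V₀ T 0) *
        ∫ ζ, Real.exp (-renormPotential D V₀ (CovDecomposition.compressTime T r) ζ) * F ζ
          ∂(multivariateGaussian 0 (D.C T - D.C (CovDecomposition.compressTime T r))) :=
  rfl

variable (hV : Measurable V₀) {b : ℝ} (hb : ∀ φ, b ≤ V₀ φ)
include hV hb

/-- **Restarting the flow at scale `s`**: the renormalised potential of the shifted decomposition started
from `V_s` is `V'_τ = V_{s+τ}` (`e^{−V_{s+τ}} = E_{C_{s+τ}−C_s}[e^{−V_s(·+w)}]`, [BBD] (e:V-def) /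
(eq: semigroup structure)). [cite: BauerschmidtBodineauDagallier2023, Definition 2] -/
theorem renormPotential_shift {s : ℝ} (hs : 0 ≤ s) {τ : ℝ} (hτ : 0 ≤ τ)
    (φ : EuclideanSpace ℝ (Fin N)) :
    renormPotential (D.shift s hs) (renormPotential D V₀ s) τ φ = renormPotential D V₀ (s + τ) φ := by
  have hW : Measurable (renormPotential D V₀ s) := measurable_renormPotential D hV s
  have hbW : ∀ φ, b ≤ renormPotential D V₀ s φ := fun φ => le_renormPotential D hV hb s φ
  have h1 := exp_neg_renormPotential (D.shift s hs) hW hbW τ φ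
  have h2 := exp_neg_renormPotential_eq_integral_sub D hV hb hs (by linarith : s ≤ s + τ) φ
  rw [CovDecomposition.shift_C] at h1
  have h := h1.trans h2.symm
  exact neg_inj.mp (Real.exp_eq_exp.mp h)

/-- The Polchinski semigroup of the shifted decomposition from time `0` is `P_{s,s+τ}`:
`P'_{0,τ}F = P_{s,s+τ}F`. [cite: BauerschmidtBodineauDagallier2023, Definition 2] -/
theorem semigroup_shift_zero {s : ℝ} (hs : 0 ≤ s) {τ : ℝ} (hτ : 0 ≤ τ)
    (F : EuclideanSpace ℝ (Fin N) → ℝ) (φ : EuclideanSpace ℝ (Fin N)) :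
    semigroup (D.shift s hs) (renormPotential D V₀ s) 0 τ F φ = semigroup D V₀ s (s + τ) F φ := by
  unfold semigroup
  rw [renormPotential_shift D hV hb hs hτ]
  simp_rw [renormPotential_zero]
  simp [CovDecomposition.shift_C]

/-- The renormalised measure of the shifted decomposition is `ν'_τ = ν_{s+τ}`:
`E_{ν'_τ}[F] = E_{ν_{s+τ}}[F]` (same normalisation, since `e^{−V'_∞(0)} = E_{C_∞−C_s}[e^{−V_s}] = e^{−V_∞(0)}`).
[cite: BauerschmidtBodineauDagallier2023, Definition 2] -/
theorem renormExpect_shift {s : ℝ} (hs : 0 ≤ s) {τ : ℝ} (hτ : 0 ≤ τ)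
    (F : EuclideanSpace ℝ (Fin N) → ℝ) :
    renormExpect (D.shift s hs) (renormPotential D V₀ s) τ F = renormExpect D V₀ (s + τ) F := by
  unfold renormExpect
  have h1 : renormPotentialInf (D.shift s hs) (renormPotential D V₀ s) 0 = renormPotentialInf D V₀ 0 := by
    unfold renormPotentialInf
    rw [CovDecomposition.shift_Cinf, ← exp_neg_renormPotentialInf_eq_integral_sub D hV hb hs 0,
      Real.log_exp, neg_neg]
    rfl
  rw [h1, CovDecomposition.shift_Cinf_sub_C]
  congr 1
  refine integral_congr_ae (Eventually.of_forall fun ζ => ?_)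
  show Real.exp (-renormPotential (D.shift s hs) (renormPotential D V₀ s) τ ζ) * F ζ = _
  rw [renormPotential_shift D hV hb hs hτ]

end Transfer

end Polchinski

end Literature.Analysis.FunctionSpaces

end
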